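import Literature.AlgebraicGeometry.Resolution.WeightedBlowupNoIncrease

/-!
# The monomialwise stall criterion at a coordinate point (pub-rosobs observatory, Proposition S′)

Companion of `WeightedBlowupNoIncrease`.  The observatory's census of the transplanted weighted
(cobordant) step found that the pair `(q, ord₀ F_clean)` STALLS at thousands of equimultiple points, and
that on its input families every stall outside two "cancellation" classes happens at a COORDINATE point
`e_j = (s = 0, u'_j = 1, u'_i = 0 (i ≠ j))` of the exceptional divisor by the following monomialwise
mechanism (PATTERNS C23, derived here, elementary; this file PROVES it):

Write the cobordant transform as `F' = Σ_β c_β s^{n_β} u'^β` (`n_β = Σ wᵢβᵢ − ℓ`).  At `e_j` the Taylor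
expansion is `Σ_β Σ_k C(β_j, k) c_β s^{n_β} u'_j^k ∏_{i≠j} u'_i^{βᵢ}`; the exponent of the `(β, k)` term is
`taylorExponent w ℓ j β k`.  **If every such exponent of degree `< ord₀ F` whose binomial coefficient is
non-zero in `K` is a `q`-th power exponent** (hypothesis `hS`), then after cleaning nothing of degree
`< ord₀ F` survives, while the initial monomials of `F` survive (`WeightedBlowupNoIncrease`): the second
entry stalls (`secondEntryStalls_of_monomialwise`), and the point is equimultiple as soon as `q ≤ ord₀ F`
(`isEquimultiplePoint_of_monomialwise`).  The p-pinch shape `u_j·H(u)^q + (harmless tails)` of the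
observatory's PATTERNS C14 is the basic instance.  Scope as in `WeightedBlowupNoIncrease` (coordinate
centres, the coordinate points `e_j` over the origin).  Published ingredients: the cobordant presentation
[AbramovichQuekSchober2025, Def. 4.5], admissibility [AbramovichTemkinWlodarczyk2024, §5.1], cleaning
[Hauser2010, §G]. [folklore]
-/

open MvPolynomial Finset

open scoped BigOperators

namespace Literature.AlgebraicGeometry.Resolution

open Literature.AlgebraicGeometry.Resolution.Hauser2010

noncomputable section

namespace WeightedBlowup

variable {σ : Type*} {K : Type*} [CommRing K] [Fintype σ] [DecidableEq σ]

/-- The exponent of the `(β, k)` term of the Taylor expansion of the cobordant transform at the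
coordinate point `e_j`: the cobordant exponent of `u^β` with its `u'_j`-entry replaced by `k`.
(derived here) [folklore] -/
def taylorExponent (w : σ → ℕ) (ℓ : ℕ) (j : σ) (β : σ →₀ ℕ) (k : ℕ) : Option σ →₀ ℕ :=
  (cobordantExponent w ℓ β).update (some j) k

omit [Fintype σ] [DecidableEq σ] in
/-- `taylorExponent` at `u'_j`. [folklore] -/
theorem taylorExponent_some_self (w : σ → ℕ) (ℓ : ℕ) (j : σ) (β : σ →₀ ℕ) (k : ℕ) :
    taylorExponent w ℓ j β k (some j) = k := by
  classical
  simp [taylorExponent, Finsupp.coe_update]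

omit [Fintype σ] [DecidableEq σ] in
/-- `taylorExponent` away from `u'_j`. [folklore] -/
theorem taylorExponent_of_ne (w : σ → ℕ) (ℓ : ℕ) (j : σ) (β : σ →₀ ℕ) (k : ℕ) {o : Option σ}
    (ho : o ≠ some j) : taylorExponent w ℓ j β k o = cobordantExponent w ℓ β o := by
  classical
  simp [taylorExponent, Finsupp.coe_update, ho]

/-- **Vanishing below the order.** Under the monomialwise hypothesis `hS` at the coordinate point `e_j`
(`b = 0` away from `u'_j`; the value `b (some j)` is irrelevant), every monomial `u'^D` of `F'(s, u' + e_j)` of degree `< n` that is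
not a `q`-th power has coefficient `0`. (derived here) [folklore] -/
theorem coeff_pointPolynomial_eq_zero_of_monomialwise (q : ℕ) (w : σ → ℕ) (ℓ : ℕ) (b : Option σ → K)
    (F : MvPolynomial σ K) (n : ℕ) (j : σ)
    (hb : ∀ o, o ≠ some j → b o = 0)
    (hS : ∀ β ∈ F.support, ∀ k ≤ β j, (taylorExponent w ℓ j β k).degree < n →
        (((β j).choose k : ℕ) : K) ≠ 0 → IsPthPowerExponent q (taylorExponent w ℓ j β k))
    (D : Option σ →₀ ℕ) (hDn : D.degree < n) (hDq : ¬ IsPthPowerExponent q D) :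
    coeff D (pointPolynomial w ℓ b F) = 0 := by
  classical
  unfold pointPolynomial cobordantTransform
  unfold PointBlowup.translate
  rw [map_sum, coeff_sum]
  change ∑ x ∈ F.support, coeff D
      (PointBlowup.translate b (monomial (cobordantExponent w ℓ x) (coeff x F))) = 0
  refine Finset.sum_eq_zero fun β hβ => ?_
  set E := cobordantExponent w ℓ β with hE
  by_cases h1 : ∃ o, E o < D o
  · obtain ⟨o, ho⟩ := h1
    exact coeff_translate_monomial_eq_zero_of_lt b E D _ ho
  by_cases h2 : ∃ o, o ≠ some j ∧ D o < E o
  · obtain ⟨o, hoj, ho⟩ := h2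
    exact coeff_translate_monomial_eq_zero_of_apply_eq_zero b E D _ (hb o hoj) ho
  push Not at h1 h2
  -- D agrees with E away from u'_j, and k := D (some j) ≤ β j
  set k := D (some j) with hk
  have hkle : k ≤ β j := by
    have := h1 (some j)
    rwa [hE, cobordantExponent_some] at this
  have hDT : D = taylorExponent w ℓ j β k := by
    ext o
    by_cases ho : o = some j
    · rw [ho, taylorExponent_some_self]
    · rw [taylorExponent_of_ne w ℓ j β k ho]
      exact le_antisymm (h1 o) (h2 o ho)
  -- so the binomial coefficient vanishes in K (else D would be a q-th power exponent)
  have hchoose : (((β j).choose k : ℕ) : K) = 0 := by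
    by_contra hne
    exact hDq (hDT ▸ hS β hβ k hkle (hDT ▸ hDn) hne)
  rw [coeff_translate_monomial]
  have hfac : (((E (some j)).choose (D (some j)) : K) * b (some j) ^ (E (some j) - D (some j))) = 0 := by
    rw [hE, cobordantExponent_some, ← hk, hchoose, zero_mul]
  rw [Finset.prod_eq_zero (Finset.mem_univ (some j)) hfac, mul_zero]

omit [Fintype σ] [DecidableEq σ] in
/-- A non-zero `q`-th power exponent has degree `≥ q`. [folklore] -/
theorem le_degree_of_isPthPowerExponent (q : ℕ) (D : Option σ →₀ ℕ) (hD : IsPthPowerExponent q D)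
    (hD0 : D ≠ 0) : q ≤ D.degree := by
  classical
  obtain ⟨o, ho⟩ : ∃ o, D o ≠ 0 := by
    by_contra h
    push Not at h
    exact hD0 (Finsupp.ext h)
  have hq : q ∣ D o := hD o (Finsupp.mem_support_iff.mpr ho)
  have hqo : q ≤ D o := Nat.le_of_dvd (Nat.pos_of_ne_zero ho) hq
  exact hqo.trans (Finsupp.le_degree o D)

/-- **Proposition S′ (monomialwise stall criterion at a coordinate point).** For `F` cleaned of order `n`,
a cocharacter `γ` admissible for `F` with `γᵢ·n ≤ 1`, weights `wᵢ = ℓγᵢ` (`ℓ > 0`), a centre variable `j`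
(`γ_j ≠ 0`) and a point `b` with `b = 0` away from `u'_j` (the coordinate point `e_j` has `b (some j) = 1`; the value is irrelevant): if every Taylor term at
`e_j` of degree `< n` with binomial coefficient non-zero in `K` has a `q`-th power exponent (`hS`), then
the second entry STALLS: `ord₀ clean_q(F'(s, u' + e_j) − F'(0, e_j)) = ord₀ F`.
(derived here: the observatory's PATTERNS C23, now proved) [folklore] -/
theorem secondEntryStalls_of_monomialwise (q : ℕ) (γ : σ → ℚ) (w : σ → ℕ) (ℓ : ℕ)
    (b : Option σ → K) (F : MvPolynomial σ K) (n : ℕ) (j : σ)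
    (hF : deletePthPowers q F = F) (hn : ordZero F = n)
    (hadm : IsAdmissibleFor γ F) (hγn : ∀ i, γ i * n ≤ 1)
    (hw : ∀ i, (w i : ℚ) = ℓ * γ i) (hℓ : 0 < ℓ)
    (hj : γ j ≠ 0) (hb : ∀ o, o ≠ some j → b o = 0)
    (hS : ∀ β ∈ F.support, ∀ k ≤ β j, (taylorExponent w ℓ j β k).degree < n →
        (((β j).choose k : ℕ) : K) ≠ 0 → IsPthPowerExponent q (taylorExponent w ℓ j β k)) :
    SecondEntryStalls q w ℓ b F := by
  classical
  have hb0 : b none = 0 := hb none (by simp)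
  have hbS : ∀ i, γ i = 0 → b (some i) = 0 := fun i hi =>
    hb (some i) (fun h => hj (by rw [Option.some_injective σ h] at hi; exact hi))
  unfold SecondEntryStalls
  rw [hF, hn]
  obtain ⟨⟨α, hα, hαn⟩, -⟩ := (ordZero_eq_nat_iff F n).mp hn
  have hαsupp : α ∈ F.support := by simpa [MvPolynomial.mem_support_iff] using hα
  -- (a) the initial monomial α survives (as in `not_secondEntryIncreases`)
  have hnotp : ¬ IsPthPowerExponent q α := by
    intro hp
    apply hα
    rw [← hF, coeff_deletePthPowers, if_pos hp]
  have hnotpD : ¬ IsPthPowerExponent q (α.mapDomain some) := by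
    intro hp
    apply hnotp
    rw [isPthPowerExponent_iff] at hp ⊢
    intro i
    simpa [mapDomain_some_some] using hp (some i)
  have hαne : α ≠ 0 := by
    rintro rfl
    have := hadm 0 hαsupp
    norm_num [monomialValuation] at this
  have hDne : α.mapDomain some ≠ 0 := by
    intro h
    apply hαne
    ext i
    have := congrArg (fun f => f (some i)) h
    simpa [mapDomain_some_some] using this
  have hkey := coeff_pointPolynomial_mapDomain_some γ w ℓ b F α n hadm hγn hw hℓ hb0 hbS hα hαn
  have hcoeff : coeff (α.mapDomain some) (newResidual q w ℓ b F) = coeff α F := by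
    unfold newResidual residual
    rw [coeff_deletePthPowers, if_neg hnotpD, coeff_sub, coeff_C, if_neg (Ne.symm hDne), sub_zero, hkey]
  -- (b) nothing of degree < n survives the cleaning
  refine (ordZero_eq_nat_iff _ n).mpr ⟨⟨α.mapDomain some, by rw [hcoeff]; exact hα,
    by rw [degree_mapDomain_some, hαn]⟩, fun D hD => ?_⟩
  unfold newResidual residual
  rw [coeff_deletePthPowers]
  by_cases hDq : IsPthPowerExponent q D
  · rw [if_pos hDq]
  rw [if_neg hDq, coeff_sub, coeff_C]
  have hD0 : D ≠ 0 := by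
    rintro rfl
    exact hDq (fun i hi => by simp at hi)
  rw [if_neg (Ne.symm hD0), sub_zero]
  exact coeff_pointPolynomial_eq_zero_of_monomialwise q w ℓ b F n j hb hS D (by exact_mod_cast hD) hDq

/-- Under the same hypotheses and `q ≤ ord₀ F`, the coordinate point `e_j` IS an equimultiple point
(every monomial of the residual of degree `< q` would be a non-constant `q`-th power). (derived here) [folklore] -/
theorem isEquimultiplePoint_of_monomialwise (q : ℕ) (w : σ → ℕ) (ℓ : ℕ)
    (b : Option σ → K) (F : MvPolynomial σ K) (n : ℕ) (j : σ)
    (hqn : q ≤ n) (hb : ∀ o, o ≠ some j → b o = 0)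
    (hS : ∀ β ∈ F.support, ∀ k ≤ β j, (taylorExponent w ℓ j β k).degree < n →
        (((β j).choose k : ℕ) : K) ≠ 0 → IsPthPowerExponent q (taylorExponent w ℓ j β k)) :
    IsEquimultiplePoint q w ℓ b F := by
  classical
  unfold IsEquimultiplePoint
  -- `q ≤ ord₀ residual`: every coefficient of degree < q vanishes
  unfold ordZero
  refine MvPowerSeries.le_order fun D hD => ?_
  rw [MvPolynomial.coeff_coe]
  have hDq' : D.degree < q := by exact_mod_cast hD
  unfold residual
  rw [coeff_sub, coeff_C]
  by_cases hD0 : D = 0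
  · subst hD0
    rw [if_pos rfl, ← MvPolynomial.constantCoeff_eq, sub_self]
  rw [if_neg (Ne.symm hD0), sub_zero]
  by_cases hDq : IsPthPowerExponent q D
  · exact absurd (le_degree_of_isPthPowerExponent q D hDq hD0) (not_le.mpr hDq')
  · exact coeff_pointPolynomial_eq_zero_of_monomialwise q w ℓ b F n j hb hS D
      (lt_of_lt_of_le hDq' hqn) hDq

end WeightedBlowup

end

end Literature.AlgebraicGeometry.Resolution
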